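import Summits.Ventures.Crystal3D.Theorems.StickyWulffConstantTextureBuildRimCount
import HarnessLib

/-!
# Texture build, TB-1: the general tiling-rim bound (defects at cap depth)

Sequel of `…TextureBuildRimCount`.  `PlacedCell.tilingRim_le_general(_linear)`: with NO hypothesis on the
configuration outside the cell except that the cell holds all configuration balls of its cylinder (`hfull`),
`tilingRim ≤ 6·(#lateralShell + #capBelow + #capAbove + #fillingNearCaps)`
(`≤ 108(2ρ+1)(h+4R₀+4) + 6·(cap terms)` with the shell count), where `capBelow` / `capAbove` are the
configuration balls in the unit shells just below / above the cylinder that are OFF the lower / upper plate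
lattice and `fillingNearCaps` the filling balls within `1` of a cap — the DEFECTS AT CAP DEPTH, each costing
`≤ 12` bonds (kissing bound).  The texture build (TB-0.md §9.9 (S3)) dodges them with a depth menu realised
through the gap parameter `h`, so that summed over the cells they cost `≤ 624·Def/m′`.
-/

noncomputable section

open scoped BigOperators InnerProductSpace

namespace Summit.Ventures.Crystal3D.Cruxes.TextureLiminf.TexShadow

open Summit.Ventures.Crystal3D Summit.Ventures.Crystal3D.Theorems Finset
open Literature.MathematicalPhysics.StatisticalMechanics (IsHaggSeq contactDeficiency)

namespace PlacedCell

variable {C R₀ : ℝ} {X' : Finset E3}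

/-! ## The general form: defects near the caps cost `≤ 12` each -/

open scoped Classical in
/-- off-lattice (w.r.t. the LOWER plate lattice) configuration balls in the unit shell just BELOW the cylinder -/
def capBelow (k : PlacedCell C R₀ X') : Finset E3 :=
  k.model.filter fun q => q 0 ^ 2 + q 1 ^ 2 ≤ (k.ρ + 1) ^ 2 ∧ -(2 * R₀) - 1 ≤ q 2 ∧ q 2 < -(2 * R₀) ∧
    q ∉ stacking k.L₁ k.s₁ k.σ₁

open scoped Classical in
/-- off-lattice (w.r.t. the UPPER plate lattice) configuration balls in the unit shell just ABOVE the cylinder -/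
def capAbove (k : PlacedCell C R₀ X') : Finset E3 :=
  k.model.filter fun q => q 0 ^ 2 + q 1 ^ 2 ≤ (k.ρ + 1) ^ 2 ∧ k.h + 2 * R₀ < q 2 ∧
    q 2 ≤ k.h + 2 * R₀ + 1 ∧ q ∉ stacking k.L₂ k.s₂ k.σ₂

open scoped Classical in
/-- filling balls within `1` of a cap (in the intended cells: none — the plates' depth windows are perfect) -/
def fillingNearCaps (k : PlacedCell C R₀ X') : Finset E3 :=
  k.F.filter fun p => p 2 < -(2 * R₀) + 1 ∨ k.h + 2 * R₀ - 1 < p 2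

/-- **General tiling-rim bound** (no hypothesis on the configuration outside the cell beyond `hfull`):
`tilingRim ≤ 6·(#lateralShell + #capBelow + #capAbove + #fillingNearCaps)`.  The three extra terms are the
DEFECTS AT CAP DEPTH of TB-0.md §9.9 (S3); the texture build dodges them with the depth menu. -/
theorem tilingRim_le_general (k : PlacedCell C R₀ X') (hR₀ : 1 ≤ R₀)
    (hX'sep : ∀ p ∈ X', ∀ q ∈ X', p ≠ q → 1 ≤ dist p q)
    (hfull : ∀ q ∈ k.model, q ∈ cyl R₀ k.h k.ρ → q ∈ k.X) :
    k.tilingRim ≤ 6 * ((k.lateralShell.card : ℝ) + k.capBelow.card + k.capAbove.card +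
      k.fillingNearCaps.card) := by
  classical
  have hρ : 0 < k.ρ := by linarith [k.hρ, hR₀]
  -- Step 1: classification of a counted pair.
  have key : ∀ p ∈ k.X, ∀ q ∈ k.model \ k.X, dist p q = 1 →
      (p ∈ k.F ∨ (p ∈ k.P₁ ∧ (q ∉ stacking k.L₁ k.s₁ k.σ₁ ∨ -R₀ < q 2)) ∨
        (p ∈ k.P₂ ∧ (q ∉ stacking k.L₂ k.s₂ k.σ₂ ∨ q 2 < k.h + R₀))) →
      p ∉ k.fillingNearCaps → q ∈ k.lateralShell ∪ k.capBelow ∪ k.capAbove := by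
    intro p hp q hq hpq hcase hpF
    rw [Finset.mem_sdiff] at hq
    have hpc := k.hcyl p hp
    simp only [cyl, Set.mem_setOf_eq] at hpc
    have hqc : q ∉ cyl R₀ k.h k.ρ := fun h => hq.2 (hfull q hq.1 h)
    simp only [cyl, Set.mem_setOf_eq, not_and_or, not_le] at hqc
    have h2 := abs_sub_apply_le_dist p q 2
    rw [hpq] at h2
    have h2' := abs_le.1 h2
    have hrad : q 0 ^ 2 + q 1 ^ 2 ≤ (k.ρ + 1) ^ 2 := by
      have hs := sqrt_radial_le p q
      rw [hpq] at hs
      have hp1 : Real.sqrt (p 0 ^ 2 + p 1 ^ 2) ≤ k.ρ := by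
        rw [Real.sqrt_le_left hρ.le]; exact hpc.2.2
      have hq0 : 0 ≤ Real.sqrt (q 0 ^ 2 + q 1 ^ 2) := Real.sqrt_nonneg _
      have := Real.sq_sqrt (show 0 ≤ q 0 ^ 2 + q 1 ^ 2 by positivity)
      nlinarith [hs, hp1, hq0]
    have hnotF : p ∈ k.F → -(2 * R₀) + 1 ≤ p 2 ∧ p 2 ≤ k.h + 2 * R₀ - 1 := by
      intro hpF'
      by_contra hcon
      apply hpF
      unfold fillingNearCaps
      rw [Finset.mem_filter]
      refine ⟨hpF', ?_⟩
      by_contra hcon2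
      push Not at hcon2
      exact hcon ⟨hcon2.1, hcon2.2⟩
    rcases hqc with hlow | hhigh | hout
    · -- q below the bottom cap: p ∈ P₁ and q off-lattice
      have hqB : q ∉ stacking k.L₁ k.s₁ k.σ₁ := by
        rcases hcase with hpF' | ⟨hpP, hq'⟩ | ⟨hpP, hq'⟩
        · have := (hnotF hpF').1; linarith
        · rcases hq' with hnS | hz
          · exact hnS
          · linarith
        · have := ((k.hP₂iff p).1 hpP).2.1; linarith [k.hh]
      refine Finset.mem_union_left _ (Finset.mem_union_right _ ?_)
      unfold capBelow
      rw [Finset.mem_filter]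
      exact ⟨hq.1, hrad, by linarith [hpc.1], hlow, hqB⟩
    · -- q above the top cap
      have hqA : q ∉ stacking k.L₂ k.s₂ k.σ₂ := by
        rcases hcase with hpF' | ⟨hpP, hq'⟩ | ⟨hpP, hq'⟩
        · have := (hnotF hpF').2; linarith
        · have := ((k.hP₁iff p).1 hpP).2.2.1; linarith [k.hh]
        · rcases hq' with hnS | hz
          · exact hnS
          · linarith
      refine Finset.mem_union_right _ ?_
      unfold capAbove
      rw [Finset.mem_filter]
      exact ⟨hq.1, hrad, hhigh, by linarith [hpc.2.1], hqA⟩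
    · refine Finset.mem_union_left _ (Finset.mem_union_left _ ?_)
      unfold lateralShell
      rw [Finset.mem_filter]
      exact ⟨hq.1, hout, hrad, by linarith [hpc.1], by linarith [hpc.2.1]⟩
  -- Step 2: the pair sets.
  have hFX : k.F ⊆ k.X := fun p hp => by
    unfold WallCell.F at hp; exact (Finset.mem_sdiff.1 (Finset.mem_sdiff.1 hp).1).1
  have hP₁X : k.P₁ ⊆ k.X := k.hP₁
  have hP₂X : k.P₂ ⊆ k.X := fun p hp => (Finset.mem_sdiff.1 (k.hP₂ hp)).1
  set Lc := k.lateralShell ∪ k.capBelow ∪ k.capAbove with hLc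
  set T₁ := (Lc ×ˢ k.model).filter fun qp : E3 × E3 => dist qp.1 qp.2 = 1 with hT₁
  set T₂ := (k.fillingNearCaps ×ˢ k.model).filter fun pq : E3 × E3 => dist pq.1 pq.2 = 1 with hT₂
  set S₀ := (k.F ×ˢ (k.model \ k.X)).filter fun pq : E3 × E3 => dist pq.1 pq.2 = 1 with hS₀
  set S₁ := (k.P₁ ×ˢ (k.model \ k.X)).filter fun pq : E3 × E3 =>
      dist pq.1 pq.2 = 1 ∧ (pq.2 ∉ stacking k.L₁ k.s₁ k.σ₁ ∨ -R₀ < pq.2 2) with hS₁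
  set S₂ := (k.P₂ ×ˢ (k.model \ k.X)).filter fun pq : E3 × E3 =>
      dist pq.1 pq.2 = 1 ∧ (pq.2 ∉ stacking k.L₂ k.s₂ k.σ₂ ∨ pq.2 2 < k.h + R₀) with hS₂
  have hdFP₁ : Disjoint k.F k.P₁ := by
    unfold WallCell.F
    exact Finset.disjoint_of_subset_left Finset.sdiff_subset Finset.sdiff_disjoint
  have hdFP₂ : Disjoint k.F k.P₂ := by
    unfold WallCell.F; exact Finset.sdiff_disjoint
  have hdP₁P₂ : Disjoint k.P₁ k.P₂ :=
    Finset.disjoint_of_subset_right k.hP₂ Finset.disjoint_sdiff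
  have hd01 : Disjoint S₀ S₁ := by
    rw [Finset.disjoint_left]; intro pq h0 h1
    rw [hS₀, Finset.mem_filter, Finset.mem_product] at h0
    rw [hS₁, Finset.mem_filter, Finset.mem_product] at h1
    exact Finset.disjoint_left.1 hdFP₁ h0.1.1 h1.1.1
  have hd02 : Disjoint S₀ S₂ := by
    rw [Finset.disjoint_left]; intro pq h0 h2
    rw [hS₀, Finset.mem_filter, Finset.mem_product] at h0
    rw [hS₂, Finset.mem_filter, Finset.mem_product] at h2
    exact Finset.disjoint_left.1 hdFP₂ h0.1.1 h2.1.1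
  have hd12 : Disjoint S₁ S₂ := by
    rw [Finset.disjoint_left]; intro pq h1 h2
    rw [hS₁, Finset.mem_filter, Finset.mem_product] at h1
    rw [hS₂, Finset.mem_filter, Finset.mem_product] at h2
    exact Finset.disjoint_left.1 hdP₁P₂ h1.1.1 h2.1.1
  have hU : (S₀ ∪ S₁ ∪ S₂).card = S₀.card + S₁.card + S₂.card := by
    rw [Finset.card_union_of_disjoint (Finset.disjoint_union_left.2 ⟨hd02, hd12⟩),
      Finset.card_union_of_disjoint hd01]
  -- every pair of the union: first coordinate in X, second in model \ X, distance 1, and the case split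
  have hmem : ∀ pq ∈ S₀ ∪ S₁ ∪ S₂, pq.1 ∈ k.X ∧ pq.2 ∈ k.model \ k.X ∧ dist pq.1 pq.2 = 1 ∧
      (pq.1 ∈ k.F ∨ (pq.1 ∈ k.P₁ ∧ (pq.2 ∉ stacking k.L₁ k.s₁ k.σ₁ ∨ -R₀ < pq.2 2)) ∨
        (pq.1 ∈ k.P₂ ∧ (pq.2 ∉ stacking k.L₂ k.s₂ k.σ₂ ∨ pq.2 2 < k.h + R₀))) := by
    intro pq hpq
    rcases Finset.mem_union.1 hpq with h01 | h2
    · rcases Finset.mem_union.1 h01 with h0 | h1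
      · rw [hS₀, Finset.mem_filter, Finset.mem_product] at h0
        exact ⟨hFX h0.1.1, h0.1.2, h0.2, Or.inl h0.1.1⟩
      · rw [hS₁, Finset.mem_filter, Finset.mem_product] at h1
        exact ⟨hP₁X h1.1.1, h1.1.2, h1.2.1, Or.inr (Or.inl ⟨h1.1.1, h1.2.2⟩)⟩
    · rw [hS₂, Finset.mem_filter, Finset.mem_product] at h2
      exact ⟨hP₂X h2.1.1, h2.1.2, h2.2.1, Or.inr (Or.inr ⟨h2.1.1, h2.2.2⟩)⟩
  -- split the union by `p ∈ fillingNearCaps`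
  set Sbad := (S₀ ∪ S₁ ∪ S₂).filter fun pq : E3 × E3 => pq.1 ∈ k.fillingNearCaps with hSbad
  set Sgood := (S₀ ∪ S₁ ∪ S₂).filter fun pq : E3 × E3 => pq.1 ∉ k.fillingNearCaps with hSgood
  have hsplit : (S₀ ∪ S₁ ∪ S₂).card = Sbad.card + Sgood.card := by
    rw [hSbad, hSgood]; exact (Finset.card_filter_add_card_filter_not _).symm
  have hbad : Sbad ⊆ T₂ := by
    intro pq hpq
    rw [hSbad, Finset.mem_filter] at hpq
    obtain ⟨-, hq, hd, -⟩ := hmem pq hpq.1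
    rw [hT₂, Finset.mem_filter, Finset.mem_product]
    exact ⟨⟨hpq.2, (Finset.mem_sdiff.1 hq).1⟩, hd⟩
  have hgood : Sgood.image Prod.swap ⊆ T₁ := by
    intro qp hqp
    rw [Finset.mem_image] at hqp
    obtain ⟨pq, hpq, rfl⟩ := hqp
    rw [hSgood, Finset.mem_filter] at hpq
    obtain ⟨hp, hq, hd, hcase⟩ := hmem pq hpq.1
    rw [hT₁, Finset.mem_filter, Finset.mem_product]
    simp only [Prod.fst_swap, Prod.snd_swap]
    refine ⟨⟨key _ hp _ hq hd hcase hpq.2, k.X_subset_model hp⟩, ?_⟩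
    rw [dist_comm]; exact hd
  -- Step 3: counting with the kissing bound.
  have hmsep : ∀ p ∈ k.model, ∀ q ∈ k.model, p ≠ q → 1 ≤ dist p q := by
    intro p hp q hq hpq
    unfold model at hp hq
    obtain ⟨p', hp', rfl⟩ := Finset.mem_image.1 hp
    obtain ⟨q', hq', rfl⟩ := Finset.mem_image.1 hq
    have hne : p' ≠ q' := fun h => hpq (by rw [h])
    have := hX'sep p' hp' q' hq' hne
    rwa [LinearIsometryEquiv.dist_map, dist_sub_right]
  have hcount : ∀ A : Finset E3,
      ((A ×ˢ k.model).filter fun qp : E3 × E3 => dist qp.1 qp.2 = 1).card ≤ 12 * A.card := by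
    intro A
    have hsum : ((A ×ˢ k.model).filter fun qp : E3 × E3 => dist qp.1 qp.2 = 1).card =
        ∑ q ∈ A, cdeg k.model q := by
      rw [Finset.card_filter, Finset.sum_product]
      refine Finset.sum_congr rfl fun q _ => ?_
      unfold cdeg
      rw [Finset.card_filter]
    calc _ = ∑ q ∈ A, cdeg k.model q := hsum
      _ ≤ ∑ q ∈ A, 12 := Finset.sum_le_sum fun q _ => cdeg_le_twelve k.model hmsep q
      _ = 12 * A.card := by rw [Finset.sum_const, smul_eq_mul, mul_comm]
  have hT₁c : T₁.card ≤ 12 * Lc.card := hcount Lc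
  have hT₂c : T₂.card ≤ 12 * k.fillingNearCaps.card := hcount k.fillingNearCaps
  have hLc3 : Lc.card ≤ k.lateralShell.card + k.capBelow.card + k.capAbove.card :=
    (Finset.card_union_le _ _).trans (by
      have := Finset.card_union_le k.lateralShell k.capBelow; omega)
  have hgoodc : Sgood.card ≤ T₁.card := by
    calc Sgood.card = (Sgood.image Prod.swap).card :=
          (Finset.card_image_of_injective _ Prod.swap_injective).symm
      _ ≤ T₁.card := Finset.card_le_card hgood
  have hbadc : Sbad.card ≤ T₂.card := Finset.card_le_card hbad
  -- Step 4: assemble.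
  have htr : k.tilingRim = ((S₀.card : ℝ) + S₁.card + S₂.card) / 2 := by
    unfold tilingRim crossCount
    rw [hS₀, hS₁, hS₂]
    ring
  rw [htr]
  have h1 : S₀.card + S₁.card + S₂.card ≤
      12 * (k.lateralShell.card + k.capBelow.card + k.capAbove.card) +
        12 * k.fillingNearCaps.card := by
    rw [← hU, hsplit]
    calc Sbad.card + Sgood.card ≤ T₂.card + T₁.card := Nat.add_le_add hbadc hgoodc
      _ ≤ 12 * k.fillingNearCaps.card + 12 * Lc.card := Nat.add_le_add hT₂c hT₁c
      _ ≤ _ := by nlinarith [hLc3]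
  have h1' : ((S₀.card : ℝ) + S₁.card + S₂.card) ≤
      12 * ((k.lateralShell.card : ℝ) + k.capBelow.card + k.capAbove.card) +
        12 * k.fillingNearCaps.card := by exact_mod_cast h1
  linarith

/-- **General tiling-rim estimate with the shell count**:
`tilingRim ≤ 108(2ρ+1)(h+4R₀+4) + 6·(#capBelow + #capAbove + #fillingNearCaps)`. -/
theorem tilingRim_le_general_linear (k : PlacedCell C R₀ X') (hR₀ : 1 ≤ R₀)
    (hX'sep : ∀ p ∈ X', ∀ q ∈ X', p ≠ q → 1 ≤ dist p q)
    (hfull : ∀ q ∈ k.model, q ∈ cyl R₀ k.h k.ρ → q ∈ k.X) :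
    k.tilingRim ≤ 108 * (2 * k.ρ + 1) * (k.h + 4 * R₀ + 4) +
      6 * ((k.capBelow.card : ℝ) + k.capAbove.card + k.fillingNearCaps.card) := by
  have h1 := k.tilingRim_le_general hR₀ hX'sep hfull
  have h2 := k.card_lateralShell_le hR₀ hX'sep
  linarith

end PlacedCell

end Summit.Ventures.Crystal3D.Cruxes.TextureLiminf.TexShadow
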